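import Summits.QuantumFields.YangMills.Theorems.BalabanUVNodesN15DefectKernelKing
import Summits.QuantumFields.YangMills.Theorems.BalabanUVNodesN15DefectKernelUnit
import Summits.QuantumFields.YangMills.Theorems.BalabanUVNodesN15DefectKernelAdjoint
import HarnessLib

/-!
# Route «BalabanUVNodes» (K4 «SpineRates»), node N15 = NE2, THE -a ∕ -b INTERFACE OF THE BACKGROUND LAYER, part 5: THE SINGLE-SCALE PIECE
# `(a_kG_kQ_k^*)·C^{(k)}·(Q_kG_k)` OF THE `U ≡ 1` PROPAGATOR — King's Prop. 3.9 mechanism (4.42)–(4.43) ASSEMBLED in binder (a)'s format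

Cell `pub-ymgap`, seat `pub-ymgap-dag-n15-a` (KNIT-BY-NAME, generation g2; HUMAN RULING D-0062; chair R424 venue; `bears_on: R4∕N15`).  Filed
`--supports stmt-QuantumFields-19351` until the node stub `S_N15` of route «BalabanUVNodes» is an item.  THEOREMS ONLY; imports BY NAME, nothing
in the tree modified: parts 1–4 of this seat (`…DefectKernel`: entries ⟺ block majorants; `…DefectKernelKing`: `hasMaj_idef_kingMinimiser_of_decay`;
`…DefectKernelUnit`: `hasMaj_idef_kingCovariance`; `…DefectKernelAdjoint`: `hasMaj_idef_transpose_of_pairedRate`, `king_weight_balance`), the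
η-rate lineage's DEFECT CALCULUS `T4EtaRateDefect` (cell `pub-balaban`, pv25: `idef_comp`, **`idef_comp_majorant`** = Leibniz + one located loss,
`slowWeight_const`), `B9SectDWeightedNeumann` (`WRow`, `wrow_of_exp`, `hasMaj_comp_wrow`), `B11SectG` (`RowSum`), and seat n18-b's
`King1986.MinimizerTwoSpacing.king_prop38_torus_of_decay`, the template lineage's `King1986.CovarianceRateTorus.king_lemma45_torus`.

THE PRINT (King, CMP **102** (1986) p. 675, verbatim — the MECHANISM assembled here; a PROVED scalar `A = 0` argument): *«For j > 0, we have the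
expansion G^{η′}_{(j)}(x′, y′) = a²_{j+n}(L^jη)^{−4} Σ_{z,w∈L^jηZ^d} (L^jη)^{2d}G^{η′}_{j+n}Q*_{j+n}(x′, z) · C^{(j+n),L^jη}(z, w)Q_{j+n}G^{η′}_{j+n}(w, y′).
(4.42)  We now replace a_{j+n}Q_{j+n}G^{η′}_{j+n}(w, y′) by a_jQ_jG^η_j(w, y) in (4.42); using Proposition 3.8 and the scaling of operators (2.20),
the error from this replacement is bounded by … ≤ CL^{−γk}(L^jη)^{2−d−γ} exp[−δ₀(L^jη)^{−1}|x − y|]. (4.43)  Clearly we can replace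
a_{j+n}G^{η′}_{j+n}Q*_{j+n}(x′z) by a_jG^η_jQ*_j(x, z), and C^{(j+n),L^jη}(z, w) by C^{(j),L^jη}(z, w), and bound the error in the same way.»*
Inputs in print: Prop. 3.8 (3.71) (tree: `king_prop38_torus[_of_decay]`), Lemma 4.5 (4.38) (tree: `king_lemma45_torus`), the uniform decay
Theorem 3.3 of all factors (HERE: binders, exactly as on p. 675).

WHAT THIS FILE PROVES.  `T4EtaRateDefect.idef_comp` is the kernel form of «replace one factor and bound the error»: `𝔇(T₁′T₂′, T₁T₂) = T₁′𝔇(T₂′,T₂) +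
𝔇(T₁′,T₁)T₂`; applied twice to `P = H∘(C∘K)` (the top single-scale piece with `H = a_kG_kQ_k^*` unit → fine, `C = C^{(k)}` unit → unit, `K = Q_kG_k =`
the Riemann-weighted transpose of `H`, fine → unit; transports: pull-back along King's pairing on the fine lattices, identity on the unit lattice)
its block-majorant form `idef_comp_majorant` ASSEMBLES the defect of the piece from the THREE factor defects — which parts 2–4 deliver BY NAME for
King's ACTUAL operators — and the uniform majorants of the undifferenced factors (binders: King's «Theorem 3.3»).
* §1 `hasMaj_idef_kingMinimiserAdjoint_of_decay` — part 4's adjoint factor WITH the exponential factor (⇐ `king_prop38_torus_of_decay` at every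
  fine point of the block, balance `w′ = w∕L^{nd}` by `king_weight_balance`): majorant `n_η·w·√(2c₀(C₁+C₂)L^{−γk})·e^{−(δ₀∕2)d}` modulo the decay
  of both minimiser kernels from the observation cube.
* §2 **`hasMaj_idef_kingPiece`** — THE ASSEMBLY: for King's actual `H = ℋ_k`, `H′ = ℋ_{k+n}` (binders `hH`, `hH′`), `C = (Δ^{(k)} + aL⁻²Q*Q)⁻¹`,
  `C′ = (Δ^{(k+n)} + aL⁻²Q*Q)⁻¹` (explicit matrices), `K = w·ℋ_kᵀ`, `K′ = (w∕L^{nd})·ℋ_{k+n}ᵀ` (binders `hK`, `hK′`), the unit torus `Ω = Π ℤ∕(LM_μ)`,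
  the fine tori `Π ℤ∕(L^kLM_μ)` ∕ `Π ℤ∕(L^nL^kLM_μ)` paired by `pr`, ANY [B6] carrier `g` ((2.54) `Triangle254`, `d ≥ 0`, SYMMETRIC distance, row sum
  (2.61) `RowSum g σ_r c_r`), ANY site assignments `blkΩ` (count `nΩ`), `blkη` (count `n_η`), fine points in the cube of their coarse point
  (`blkη ∘ pr`), the C-dominance `δ_C·d ≤ δ₄₅·tdist` of part 3, King's «Theorem 3.3» as binders (decay `c₀e^{−δ₀d}` of both minimiser kernels from the
  observation cube; ONE block majorant `N₀`, `‖N₀‖_ρ ≤ m₀`, for both covariances), and a rate `ρ ≥ 0` with `ρ + σ_r ≤ δ₀∕2`, `ρ + σ_r ≤ δ_C`: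
  `𝔇(H′C′K′, HCK)` through (pull, pull) has the block majorant
  `[nΩc₀c_r·(m₀·ε_K + nΩR_Cc_r·a_K) + nΩR_Hc_r·m₀·a_K]·e^{−ρd(y,y′)}`, `ε_K = n_ηwR_H`, `a_K = n_ηwc₀`, `R_H = √(2c₀(C₁+C₂)L^{−γk})`, `R_C = K₄₅L^{−k}`
  — THREE replacement errors, each with ONE rate factor and the normalisation `n_η·w` (`= L^{kd}·η^d = 1` for Riemann weights), as in (4.43).
  THE EXPONENT OF THE MINIMISER LEGS IS HALVED: `R_H = √(2c₀(C₁+C₂)L^{−γk}) ∝ L^{−(γ∕2)k}` against (4.43)'s `L^{−γk}` — inherited from n18-b's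
  `king_prop38_torus_of_decay` (`γ′ = γ∕2`, `δ₀′ = δ₀∕2`: the sup-norm rate of `king_prop38_torus` is interpolated against Theorem 3.3's decay by a
  geometric mean, King p. 674 «combining our bounds with Theorem 3.3»), so the piece carries King's family of rates under `γ ↦ γ∕2` (a loss only at the
  top of `γ ∈ [0,1]`); the covariance leg `R_C = K₄₅L^{−k}` is unhalved (dag-ref-B READ #87 NOTE, answered; v1.0.1, docstring only).

HONEST FRAMING ∕ LIMITS.  King's scalar `A = 0` MODEL of binder (a) (NE2⁰ for one single-scale piece of the `U ≡ 1` propagator, fine → fine through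
the pull-back pairing) — the SCALAR TEMPLATE of the -a lane «vector layer by the scalar template» in n15-b's currency, kernel-assembled from printed
and proved inputs; Theorem 3.3's decay and the covariance majorants are BINDERS (p. 675's own inputs); the telescoping over `j` ((2.17)∕(3.60)), the
`j = 0` piece and the prefactor bookkeeping `(L^jη)^{2−d}` (tree `King1986.SingleScaleRate.scale_bookkeeping`) are NOT re-done here; NOT Bałaban's
Landau-gauge∕covariant objects (their `H_k` two-spacing rate is NOT PRINTED); NE2⁺ NOT PRINTED ∕ not proved; count-neutral (typed 28∕28 ·
discharged unchanged); NOT a discharge of N15; one finite T⁴ at fixed ε — NOT infinite volume, NOT OS on ℝ⁴, NOT a mass gap, NOT Clay.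
-/

noncomputable section

namespace Summit.QuantumFields.YangMills.BalabanUVNodes.N15.DefectKernel

open Literature.MathematicalPhysics.QuantumFieldTheory.Balaban1983to89
open Literature.MathematicalPhysics.QuantumFieldTheory.Balaban1983to89.B11SectG (BlockNorm HasMaj RowSum)
open Literature.MathematicalPhysics.QuantumFieldTheory.Balaban1983to89.T4EtaRateDefect (idef idef_comp_majorant
  slowWeight_const)
open Literature.MathematicalPhysics.QuantumFieldTheory.Balaban1983to89.T4EtaRateCoeffDefect (pull fibre)
open Literature.MathematicalPhysics.QuantumFieldTheory.Balaban1983to89.B9SectDWeightedNeumann (WRow wrow_of_exp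
  hasMaj_comp_wrow)
open Literature.MathematicalPhysics.QuantumFieldTheory.Balaban1983to89.B6RandomWalk (Triangle254)
open Literature.MathematicalPhysics.QuantumFieldTheory.Balaban1983to89.B5Prop11Plancherel (Tor fine)
open Literature.MathematicalPhysics.QuantumFieldTheory.King1986 (aK prop38RateConst prop38PosConst lemma43Const
  exp_decay_mono)
open Literature.MathematicalPhysics.QuantumFieldTheory.King1986.Torus (minimiser effLaplacian blockProj tdistT K45 delta45
  K45_nonneg king_prop38_torus_of_decay)

variable {d : ℕ}

/-! ## §1 The adjoint factor with the exponential factor (modulo Theorem 3.3's decay) -/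

/-- **KING'S ADJOINT MINIMISER WITH DECAY, IN BINDER (a)'s FORMAT** (part 4's `hasMaj_idef_kingMinimiserAdjoint` ⇐ `king_prop38_torus_of_decay`):
if both minimiser kernels decay from the observation cube, `|ℋ_k(x, b)| ≤ c₀e^{−δ₀d(blk_Ω b, blk_η x)}` and `|ℋ_{k+n}(x′, b)| ≤
c₀e^{−δ₀d(blk_Ω b, blk_η(pr x′))}` (Theorem 3.3, binders), the Riemann-weighted transposes `K = w·ℋ_kᵀ`, `K′ = (w∕L^{nd})·ℋ_{k+n}ᵀ` have
`𝔇(K′,K) ≤ n_η·w·√(2c₀(C₁+C₂)L^{−γk})·e^{−(δ₀∕2)d(y,y′)}` through (pull on sources, identity on observations). [cite: King1986, Prop. 3.8 (3.71) p.664 + p.675 «bound the error in the same way»] -/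
theorem hasMaj_idef_kingMinimiserAdjoint_of_decay (hd : 0 < d) {L : ℕ} [NeZero L] (hLodd : Odd L) (hL : 2 ≤ L)
    {k n : ℕ} (hk : 1 ≤ k) (hn : 1 ≤ n) (M : Fin d → ℕ) [hM : ∀ μ, NeZero (M μ)] {a m2 : ℝ} (ha : 0 < a)
    (hm : 0 < m2) {γ : ℝ} (hγ0 : 0 ≤ γ) (hγ1 : γ ≤ 1) {g : B6.Geometry} [DecidableEq g.Site]
    (blkX : Tor (fine (L ^ k) M) → g.Site) (blkY : Tor M → g.Site) {n₀ : ℕ} (hn₀ : ∀ y', (fibre blkX y').card ≤ n₀)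
    (pr : Tor (fine (L ^ n * L ^ k) M) → Tor (fine (L ^ k) M)) (hpr : ∀ x' μ, (pr x' μ).val = (x' μ).val / L ^ n)
    (H : (Tor M → ℝ) →ₗ[ℝ] (Tor (fine (L ^ k) M) → ℝ))
    (hH : ∀ φ, H φ = minimiser (L ^ k) M (aK a L k) (((L ^ k : ℕ) : ℝ) ^ 2) m2 φ)
    (H' : (Tor M → ℝ) →ₗ[ℝ] (Tor (fine (L ^ n * L ^ k) M) → ℝ))
    (hH' : ∀ φ, H' φ = minimiser (L ^ n * L ^ k) M (aK a L (k + n)) (((L ^ n * L ^ k : ℕ) : ℝ) ^ 2) m2 φ)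
    {w : ℝ} (hw0 : 0 ≤ w) (K : (Tor (fine (L ^ k) M) → ℝ) →ₗ[ℝ] (Tor M → ℝ))
    (hK : ∀ x b, K (Pi.single x 1) b = w * H (Pi.single b 1) x)
    (K' : (Tor (fine (L ^ n * L ^ k) M) → ℝ) →ₗ[ℝ] (Tor M → ℝ))
    (hK' : ∀ x' b, K' (Pi.single x' 1) b = w / ((L : ℝ) ^ n) ^ d * H' (Pi.single b 1) x') {c₀ δ₀ : ℝ}
    (hdecH : ∀ (b : Tor M) (x : Tor (fine (L ^ k) M)),
      |H (Pi.single b 1) x| ≤ c₀ * Real.exp (-(δ₀ * g.dist (blkY b) (blkX x))))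
    (hdecH' : ∀ (b : Tor M) (x' : Tor (fine (L ^ n * L ^ k) M)),
      |H' (Pi.single b 1) x'| ≤ c₀ * Real.exp (-(δ₀ * g.dist (blkY b) (blkX (pr x'))))) :
    HasMaj (BlockNorm.ofBlocks g blkX) (BlockNorm.ofBlocks g blkY) (idef (pull pr) LinearMap.id K' K)
      (fun y y' => n₀ * (w * (Real.sqrt ((prop38RateConst a a (lemma43Const a L k n) ((Real.pi ^ 2 / 4) ^ d) d γ
          + prop38PosConst a ((Real.pi ^ 2 / 4) ^ d) d γ) * ((L ^ k : ℕ) : ℝ) ^ (-γ) * (2 * c₀))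
        * Real.exp (-(δ₀ / 2 * g.dist y y'))))) := by
  have hw' : 0 ≤ w / ((L : ℝ) ^ n) ^ d := div_nonneg hw0 (pow_nonneg (pow_nonneg (Nat.cast_nonneg _) _) _)
  refine hasMaj_idef_transpose_of_pairedRate blkX blkY hn₀ pr hw0 hw' hK hK' (king_weight_balance L k n M pr hpr w)
    (κ := fun y y' => Real.sqrt _ * Real.exp (-(δ₀ / 2 * g.dist y y')))
    (fun _ _ => mul_nonneg (Real.sqrt_nonneg _) (Real.exp_nonneg _)) fun b x' => ?_
  have hA := hdecH b (pr x')
  have hB := hdecH' b x'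
  rw [hH] at hA
  rw [hH'] at hB
  rw [hH', hH]
  exact king_prop38_torus_of_decay hd hLodd hL hk hn M ha hm hγ0 hγ1 b (pr x') x' (hpr x') hA hB

/-! ## §2 The assembly: `𝔇(H′C′K′, HCK)` from the three factor defects and the uniform majorants (King p. 675) -/

/-- **KING'S SINGLE-SCALE PIECE (4.42) IN BINDER (a)'s FORMAT — the defect of `P = ℋ_k·C^{(k)}·(w·ℋ_kᵀ)` against
`P′ = ℋ_{k+n}·C^{(k+n)}·((w∕L^{nd})·ℋ_{k+n}ᵀ)` through King's pairing (pull-back on both fine sides, identity on the unit lattice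
`Ω = Π ℤ∕(LM_μ)`), ASSEMBLED by `T4EtaRateDefect.idef_comp_majorant` (twice) from parts 2–4 and this file's §1.**  Binders: King's actual
operators read off as linear maps (`hH`, `hH′`, `hK`, `hK′`), the pairing `hpr`; the [B6] carrier's (2.54), `d ≥ 0`, symmetry and row sum (2.61)
at rate `σ_r` with constant `c_r`; the C-dominance of part 3; Theorem 3.3 as on p. 675: decay `c₀e^{−δ₀d}` of both minimiser kernels from the
observation cube and one block majorant `N₀ ≥ 0`, `‖N₀‖_ρ ≤ m₀`, of both covariances; rates `0 ≤ ρ`, `0 ≤ σ_r`, `ρ + σ_r ≤ δ₀∕2`, `ρ + σ_r ≤ δ_C`.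
Conclusion: the block majorant `[nΩc₀c_r·(m₀ε_K + nΩR_Cc_r·a_K) + nΩR_Hc_r·m₀·a_K]·e^{−ρd(y,y′)}` with `ε_K = n_ηwR_H`, `a_K = n_ηwc₀`,
`R_H = √((C₁+C₂)L^{−γk}·2c₀)`, `R_C = K₄₅L^{−k}` — three replacement errors, one rate factor each. [cite: King1986, (4.42)–(4.43) p.675; Prop. 3.8 (3.71) p.664; Lemma 4.5 (4.38) p.674] -/
theorem hasMaj_idef_kingPiece (hd : 0 < d) {L : ℕ} [NeZero L] (hLodd : Odd L) (hL : 2 ≤ L) {k n : ℕ} (hk : 1 ≤ k)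
    (hn : 1 ≤ n) (M : Fin d → ℕ) [hM : ∀ μ, NeZero (M μ)] {a m2 : ℝ} (ha : 0 < a) (hm : 0 < m2) {γ : ℝ}
    (hγ0 : 0 ≤ γ) (hγ1 : γ ≤ 1)
    -- the carrier and the site assignments
    {g : B6.Geometry} [DecidableEq g.Site] (htri : Triangle254 g) (hdist : ∀ y y' : g.Site, 0 ≤ g.dist y y')
    (hsymm : ∀ y y' : g.Site, g.dist y y' = g.dist y' y) {σr cr : ℝ} (hσr : 0 ≤ σr) (hrow : RowSum g σr cr)
    (blkΩ : Tor (fine L M) → g.Site) {nΩ : ℕ} (hnΩ : ∀ y', (fibre blkΩ y').card ≤ nΩ)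
    (blkη : Tor (fine (L ^ k) (fine L M)) → g.Site) {nη : ℕ} (hnη : ∀ y', (fibre blkη y').card ≤ nη)
    (pr : Tor (fine (L ^ n * L ^ k) (fine L M)) → Tor (fine (L ^ k) (fine L M)))
    (hpr : ∀ x' μ, (pr x' μ).val = (x' μ).val / L ^ n)
    -- King's actual operators, read off as linear maps
    (H : (Tor (fine L M) → ℝ) →ₗ[ℝ] (Tor (fine (L ^ k) (fine L M)) → ℝ))
    (hH : ∀ φ, H φ = minimiser (L ^ k) (fine L M) (aK a L k) (((L ^ k : ℕ) : ℝ) ^ 2) m2 φ)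
    (H' : (Tor (fine L M) → ℝ) →ₗ[ℝ] (Tor (fine (L ^ n * L ^ k) (fine L M)) → ℝ))
    (hH' : ∀ φ, H' φ = minimiser (L ^ n * L ^ k) (fine L M) (aK a L (k + n)) (((L ^ n * L ^ k : ℕ) : ℝ) ^ 2) m2 φ)
    {w : ℝ} (hw0 : 0 ≤ w) (K : (Tor (fine (L ^ k) (fine L M)) → ℝ) →ₗ[ℝ] (Tor (fine L M) → ℝ))
    (hK : ∀ x b, K (Pi.single x 1) b = w * H (Pi.single b 1) x)
    (K' : (Tor (fine (L ^ n * L ^ k) (fine L M)) → ℝ) →ₗ[ℝ] (Tor (fine L M) → ℝ))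
    (hK' : ∀ x' b, K' (Pi.single x' 1) b = w / ((L : ℝ) ^ n) ^ d * H' (Pi.single b 1) x')
    -- Theorem 3.3 (binders): decay of both minimiser kernels; one block majorant of both covariances
    {c₀ δ₀ : ℝ} (hc₀ : 0 ≤ c₀)
    (hdecH : ∀ (b : Tor (fine L M)) (x : Tor (fine (L ^ k) (fine L M))),
      |H (Pi.single b 1) x| ≤ c₀ * Real.exp (-(δ₀ * g.dist (blkΩ b) (blkη x))))
    (hdecH' : ∀ (b : Tor (fine L M)) (x' : Tor (fine (L ^ n * L ^ k) (fine L M))),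
      |H' (Pi.single b 1) x'| ≤ c₀ * Real.exp (-(δ₀ * g.dist (blkΩ b) (blkη (pr x')))))
    {N₀ : g.Site → g.Site → ℝ} {m₀ : ℝ} (hN₀ : ∀ y y', 0 ≤ N₀ y y') {ρ : ℝ} (hρ : 0 ≤ ρ) (hm₀ : WRow g ρ N₀ m₀)
    (hCmaj : HasMaj (BlockNorm.ofBlocks g blkΩ) (BlockNorm.ofBlocks g blkΩ)
      (Matrix.mulVecLin (effLaplacian (L ^ k) (fine L M) (aK a L k) (((L ^ k : ℕ) : ℝ) ^ 2) m2
        + (a * ((L : ℝ) ^ 2)⁻¹) • blockProj L M)⁻¹) N₀)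
    (hC'maj : HasMaj (BlockNorm.ofBlocks g blkΩ) (BlockNorm.ofBlocks g blkΩ)
      (Matrix.mulVecLin (effLaplacian (L ^ n * L ^ k) (fine L M) (aK a L (k + n)) (((L ^ n * L ^ k : ℕ) : ℝ) ^ 2) m2
        + (a * ((L : ℝ) ^ 2)⁻¹) • blockProj L M)⁻¹) N₀)
    -- the C-dominance of part 3 and the rate window
    {δC : ℝ} (hdom : ∀ x z, δC * g.dist (blkΩ x) (blkΩ z) ≤ delta45 d a L * tdistT (fine L M) x z)
    (hρ₁ : ρ + σr ≤ δ₀ / 2) (hρ₂ : ρ + σr ≤ δC) :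
    HasMaj (BlockNorm.ofBlocks g blkη) (BlockNorm.ofBlocks g (blkη ∘ pr))
      (idef (pull pr) (pull pr)
        (H' ∘ₗ (Matrix.mulVecLin (effLaplacian (L ^ n * L ^ k) (fine L M) (aK a L (k + n))
            (((L ^ n * L ^ k : ℕ) : ℝ) ^ 2) m2 + (a * ((L : ℝ) ^ 2)⁻¹) • blockProj L M)⁻¹ ∘ₗ K'))
        (H ∘ₗ (Matrix.mulVecLin (effLaplacian (L ^ k) (fine L M) (aK a L k) (((L ^ k : ℕ) : ℝ) ^ 2) m2
            + (a * ((L : ℝ) ^ 2)⁻¹) • blockProj L M)⁻¹ ∘ₗ K)))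
      (fun y y' =>
        (nΩ * c₀ * cr *
            (m₀ * (nη * w * Real.sqrt ((prop38RateConst a a (lemma43Const a L k n) ((Real.pi ^ 2 / 4) ^ d) d γ
                + prop38PosConst a ((Real.pi ^ 2 / 4) ^ d) d γ) * ((L ^ k : ℕ) : ℝ) ^ (-γ) * (2 * c₀)))
              + nΩ * (K45 d a L * ((L : ℝ) ^ k)⁻¹) * cr * (nη * w * c₀))
          + nΩ * Real.sqrt ((prop38RateConst a a (lemma43Const a L k n) ((Real.pi ^ 2 / 4) ^ d) d γ
                + prop38PosConst a ((Real.pi ^ 2 / 4) ^ d) d γ) * ((L ^ k : ℕ) : ℝ) ^ (-γ) * (2 * c₀)) * cr *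
            (m₀ * (nη * w * c₀))) *
        Real.exp (-(ρ * g.dist y y'))) := by
  -- names for King's constants
  set S : ℝ := (prop38RateConst a a (lemma43Const a L k n) ((Real.pi ^ 2 / 4) ^ d) d γ
    + prop38PosConst a ((Real.pi ^ 2 / 4) ^ d) d γ) * ((L ^ k : ℕ) : ℝ) ^ (-γ) with hS
  set RH : ℝ := Real.sqrt (S * (2 * c₀)) with hRH
  set RC : ℝ := K45 d a L * ((L : ℝ) ^ k)⁻¹ with hRC
  set C := Matrix.mulVecLin (effLaplacian (L ^ k) (fine L M) (aK a L k) (((L ^ k : ℕ) : ℝ) ^ 2) m2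
    + (a * ((L : ℝ) ^ 2)⁻¹) • blockProj L M)⁻¹ with hCdef
  set C' := Matrix.mulVecLin (effLaplacian (L ^ n * L ^ k) (fine L M) (aK a L (k + n))
    (((L ^ n * L ^ k : ℕ) : ℝ) ^ 2) m2 + (a * ((L : ℝ) ^ 2)⁻¹) • blockProj L M)⁻¹ with hC'def
  have hRH0 : 0 ≤ RH := Real.sqrt_nonneg _
  have hδ₀ : ρ ≤ δ₀ := by linarith
  have hδ₀2 : ρ ≤ δ₀ / 2 := by linarith
  have hnηw : 0 ≤ (nη : ℝ) * w := mul_nonneg (Nat.cast_nonneg _) hw0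
  -- (i) the undifferenced COARSE adjoint factor `K`: `a_K·e^{−ρd}`, `a_K = n_η w c₀`
  have hKmaj : HasMaj (BlockNorm.ofBlocks g blkη) (BlockNorm.ofBlocks g blkΩ) K
      (fun y y' => nη * w * c₀ * Real.exp (-((ρ + 0) * g.dist y y'))) := by
    have key := hasMaj_ofBlocks_of_entry_le blkη blkΩ (T := K)
      (κ := fun y y' => w * c₀ * Real.exp (-(ρ * g.dist y y')))
      (fun _ _ => mul_nonneg (mul_nonneg hw0 hc₀) (Real.exp_nonneg _)) hnη fun b x => by
        rw [hK, abs_mul, abs_of_nonneg hw0, mul_assoc]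
        refine mul_le_mul_of_nonneg_left ((hdecH b x).trans ?_) hw0
        exact exp_decay_mono hc₀ hδ₀ (hdist _ _)
    refine key.mono fun y y' => le_of_eq ?_
    rw [add_zero]; ring
  have hKmaj' : HasMaj (BlockNorm.ofBlocks g blkη) (BlockNorm.ofBlocks g blkΩ) K
      (fun y y' => nη * w * c₀ * Real.exp (-(ρ * g.dist y y'))) := by
    simpa only [add_zero] using hKmaj
  -- (ii) the DEFECT of the adjoint factor (§1), read at rate `ρ`: `ε_K·e^{−ρd}·1`, `ε_K = n_η w R_H`
  have hDK : HasMaj (BlockNorm.ofBlocks g blkη) (BlockNorm.ofBlocks g blkΩ) (idef (pull pr) LinearMap.id K' K)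
      (fun y y' => nη * w * RH * Real.exp (-(ρ * g.dist y y')) * (fun _ : g.Site => (1 : ℝ)) y') := by
    have key := hasMaj_idef_kingMinimiserAdjoint_of_decay hd hLodd hL hk hn (fine L M) ha hm hγ0 hγ1 blkη blkΩ hnη
      pr hpr H hH H' hH' hw0 K hK K' hK' hdecH hdecH'
    refine key.mono fun y y' => ?_
    have h1 : RH * Real.exp (-(δ₀ / 2 * g.dist y y')) ≤ RH * Real.exp (-(ρ * g.dist y y')) :=
      exp_decay_mono hRH0 hδ₀2 (hdist _ _)
    calc (nη : ℝ) * (w * (RH * Real.exp (-(δ₀ / 2 * g.dist y y')))) = nη * w * (RH * Real.exp (-(δ₀ / 2 * g.dist y y'))) := by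
          ring
      _ ≤ nη * w * (RH * Real.exp (-(ρ * g.dist y y'))) := mul_le_mul_of_nonneg_left h1 hnηw
      _ = nη * w * RH * Real.exp (-(ρ * g.dist y y')) * 1 := by ring
  -- (iii) the DEFECT of the covariance (part 3): `N_C·1`, `N_C = nΩ R_C e^{−δ_C d}`, `‖N_C‖_ρ ≤ nΩ R_C c_r`
  have hDC : HasMaj (BlockNorm.ofBlocks g blkΩ) (BlockNorm.ofBlocks g blkΩ) (idef LinearMap.id LinearMap.id C' C)
      (fun y y' => nΩ * RC * Real.exp (-(δC * g.dist y y')) * (fun _ : g.Site => (1 : ℝ)) y') := by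
    have key := hasMaj_idef_kingCovariance (d := d) ha hm hL hk hn M blkΩ hnΩ hdom
    exact key.mono fun y y' => le_of_eq (by rw [mul_one])
  have hRC0 : 0 ≤ RC := mul_nonneg (K45_nonneg a L) (inv_nonneg.mpr (pow_nonneg (Nat.cast_nonneg _) _))
  have hNC_wrow : WRow g ρ (fun y y' => nΩ * RC * Real.exp (-(δC * g.dist y y'))) (nΩ * RC * cr) :=
    wrow_of_exp hdist hrow (mul_nonneg (Nat.cast_nonneg _) hRC0) hρ₂
  -- (iv) the undifferenced FINE covariance `C′`: binder `N₀`, `‖N₀‖_ρ ≤ m₀`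
  -- STEP 1: `𝔇(C′K′, CK) ≤ (m₀ ε_K + nΩ R_C c_r a_K)·e^{−ρd}`
  have step1 := idef_comp_majorant (b₁ := BlockNorm.ofBlocks g blkη) (b₂ := BlockNorm.ofBlocks g blkΩ)
    (b₂' := BlockNorm.ofBlocks g blkΩ) (b₃' := BlockNorm.ofBlocks g blkΩ)
    (τ₁ := pull pr) (τ₂ := LinearMap.id) (τ₃ := LinearMap.id) (T₁' := C') (T₂' := K') (T₁ := C) (T₂ := K)
    (w := fun _ => (1 : ℝ)) (σ := 0) (C := 1)
    htri hρ (fun _ => zero_le_one) (slowWeight_const 1) zero_le_one (mul_nonneg hnηw hRH0)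
    (mul_nonneg hnηw hc₀) hN₀ hm₀ (fun y y' => mul_nonneg (mul_nonneg (Nat.cast_nonneg _) hRC0) (Real.exp_nonneg _))
    hNC_wrow hC'maj hDK hDC hKmaj
  -- (v) the undifferenced FINE minimiser `H′`: `nΩ c₀ e^{−δ₀ d}`, `‖·‖_ρ ≤ nΩ c₀ c_r`
  have hH'maj : HasMaj (BlockNorm.ofBlocks g blkΩ) (BlockNorm.ofBlocks g (blkη ∘ pr)) H'
      (fun y y' => nΩ * (c₀ * Real.exp (-(δ₀ * g.dist y y')))) :=
    hasMaj_ofBlocks_of_entry_le blkΩ (blkη ∘ pr) (T := H') (κ := fun y y' => c₀ * Real.exp (-(δ₀ * g.dist y y')))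
      (fun _ _ => mul_nonneg hc₀ (Real.exp_nonneg _)) hnΩ fun x' b => by
        rw [Function.comp_apply, hsymm]
        exact hdecH' b x'
  have hH'wrow : WRow g ρ (fun y y' => nΩ * (c₀ * Real.exp (-(δ₀ * g.dist y y')))) (nΩ * c₀ * cr) := by
    have h := wrow_of_exp (ρ := ρ) (θ := nΩ * c₀) (δ := δ₀) hdist hrow (mul_nonneg (Nat.cast_nonneg _) hc₀)
      (by linarith)
    exact h.mono fun y y' => le_of_eq (by ring)
  -- (vi) the DEFECT of the minimiser (part 2, with decay): `nΩ R_H e^{−(δ₀/2)d}·1`, `‖·‖_ρ ≤ nΩ R_H c_r`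
  have hDH : HasMaj (BlockNorm.ofBlocks g blkΩ) (BlockNorm.ofBlocks g (blkη ∘ pr)) (idef LinearMap.id (pull pr) H' H)
      (fun y y' => nΩ * (RH * Real.exp (-(δ₀ / 2 * g.dist y y'))) * (fun _ : g.Site => (1 : ℝ)) y') := by
    have key := hasMaj_idef_kingMinimiser_of_decay hd hLodd hL hk hn (fine L M) ha hm hγ0 hγ1 blkΩ (blkη ∘ pr) hnΩ
      pr hpr H hH H' hH' (c₀ := c₀) (δ₀ := δ₀)
      (fun b x' => by rw [Function.comp_apply, hsymm]; exact hdecH b (pr x'))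
      (fun b x' => by rw [Function.comp_apply, hsymm]; exact hdecH' b x')
    exact key.mono fun y y' => le_of_eq (by rw [mul_one])
  have hDH_wrow : WRow g ρ (fun y y' => nΩ * (RH * Real.exp (-(δ₀ / 2 * g.dist y y')))) (nΩ * RH * cr) := by
    have h := wrow_of_exp (θ := nΩ * RH) (δ := δ₀ / 2) hdist hrow (mul_nonneg (Nat.cast_nonneg _) hRH0) hρ₁
    exact h.mono fun y y' => le_of_eq (by ring)
  -- (vii) the undifferenced COARSE product `C∘K`: `1·m₀·a_K·e^{−ρd}`
  have hCK : HasMaj (BlockNorm.ofBlocks g blkη) (BlockNorm.ofBlocks g blkΩ) (C ∘ₗ K)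
      (fun y y' => (BlockNorm.ofBlocks g blkΩ).κ * m₀ * (nη * w * c₀) * Real.exp (-((ρ + 0) * g.dist y y'))) := by
    have h := hasMaj_comp_wrow htri hρ (mul_nonneg hnηw hc₀) hN₀ hm₀ hCmaj hKmaj'
    simpa only [add_zero] using h
  have hκ : (BlockNorm.ofBlocks g blkΩ).κ = 1 := rfl
  have hm₀0 : 0 ≤ m₀ := hm₀.nonneg hN₀ (blkΩ 0)
  have hcr0 : 0 ≤ cr := le_trans (Finset.sum_nonneg fun _ _ => (Real.exp_pos _).le) (hrow (blkΩ 0))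
  have hεCK : 0 ≤ (BlockNorm.ofBlocks g blkΩ).κ * m₀ * (nη * w * RH)
      + (BlockNorm.ofBlocks g blkΩ).κ * (nΩ * RC * cr) * (nη * w * c₀) * 1 := by
    rw [hκ]
    have := mul_nonneg hnηw hRH0
    have := mul_nonneg hnηw hc₀
    positivity
  have haCK : 0 ≤ (BlockNorm.ofBlocks g blkΩ).κ * m₀ * (nη * w * c₀) := by
    rw [hκ]
    have := mul_nonneg hnηw hc₀
    positivity
  -- STEP 2: `𝔇(H′(C′K′), H(CK))`
  have step2 := idef_comp_majorant (b₁ := BlockNorm.ofBlocks g blkη) (b₂ := BlockNorm.ofBlocks g blkΩ)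
    (b₂' := BlockNorm.ofBlocks g blkΩ) (b₃' := BlockNorm.ofBlocks g (blkη ∘ pr))
    (τ₁ := pull pr) (τ₂ := LinearMap.id) (τ₃ := pull pr) (T₁' := H') (T₂' := C' ∘ₗ K') (T₁ := H) (T₂ := C ∘ₗ K)
    (w := fun _ => (1 : ℝ)) (σ := 0) (C := 1)
    htri hρ (fun _ => zero_le_one) (slowWeight_const 1) zero_le_one hεCK haCK
    (fun y y' => mul_nonneg (Nat.cast_nonneg _) (mul_nonneg hc₀ (Real.exp_nonneg _))) hH'wrow
    (fun y y' => mul_nonneg (Nat.cast_nonneg _) (mul_nonneg hRH0 (Real.exp_nonneg _))) hDH_wrow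
    hH'maj step1 hDH hCK
  refine step2.mono fun y y' => le_of_eq ?_
  simp only [hκ]
  ring

end Summit.QuantumFields.YangMills.BalabanUVNodes.N15.DefectKernel
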